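import Literature.NumberTheory.Automorphic.FiniteAdeleSchwartzBruhatDirectSum
import Literature.NumberTheory.Automorphic.AdelicSchwartzBruhatDirectSum
import HarnessLib

/-!
# The tensor map `𝒮(𝔸_K^{ι₁}) × 𝒮(𝔸_K^{ι₂}) → 𝒮(𝔸_K^{ι₁ ⊕ ι₂})` on pure tensors, and the two-scalar assembly

Topic `NumberTheory/Automorphic`; namespace `Literature.NumberTheory.Automorphic`. Origin: `pub-hodgecm`
MODEL-CONSTRUCTION sub-cell, node W2-⊗ / (⊗S)-𝔸 (iii), leaf (d3) of RULING W2-⊗ (⊗S-split). KERNEL MATHEMATICS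
ONLY: every declaration below is proved; no `def … : Prop` record, no cited hypothesis, no new object.

The adelic Schwartz–Bruhat space of `𝔸_K^ι` is `𝒮(𝔸_K^ι) = 𝓢((K ⊗ ℝ)^ι) ⊗_ℂ 𝒮((𝔸_K^∞)^ι)`
(`piSchwartzBruhatEquiv`, file `AdelicSchwartzBruhatTensor`), the finite factor of a direct sum of index sets is
the algebraic tensor product of the factors (`finSumEquiv : FinSB K ι₁ ⊗ FinSB K ι₂ ≃ₗ FinSB K (ι₁ ⊕ ι₂)`, file
`FiniteAdeleSchwartzBruhatDirectSum`), and the external product `Φ₁ ⊠ Φ₂` of adelic Schwartz–Bruhat functions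
is the bilinear map `tensorToSum K ι₁ ι₂` (file `AdelicSchwartzBruhatDirectSum`). This file records how these
three pieces of vocabulary fit together — pure bookkeeping, no analysis:

* §1 `tensorToSum_tmul`: on pure tensors, `(Φ₁^∞ ⊗ f₁) ⊠ (Φ₂^∞ ⊗ f₂) = (Φ₁^∞ ⊠_∞ Φ₂^∞) ⊗ (f₁ ⊠_f f₂)`, where
  `⊠_∞ = archBoxTensor` (the honest product of Schwartz functions in separate variables on `(K ⊗ ℝ)^{ι₁ ⊕ ι₂}`)
  and `f₁ ⊠_f f₂ = finSumEquiv (f₁ ⊗ f₂)`; also in the `piSchwartzBruhatSumEquiv` (triple tensor) form;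
* §2 naturality of `⊠` under tensor-product operators `adelicTensorEnd A B = A ⊗ B` on pure tensors;
* §3 **the two-scalar assembly lemma**: if an archimedean operator `A` on `𝓢((K ⊗ ℝ)^{ι₁ ⊕ ι₂})` acts on
  separate-variable products by `A (Φ₁ ⊠_∞ Φ₂) = c_∞ • (A₁ Φ₁ ⊠_∞ A₂ Φ₂)` and a finite operator `M_f` on
  `𝒮((𝔸_K^∞)^{ι₁ ⊕ ι₂})` acts by `M_f (f₁ ⊠_f f₂) = c_f • (M₁ f₁ ⊠_f M₂ f₂)`, then the adelic operator
  `A ⊗ M_f` acts on adelic products by the PRODUCT scalar: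
  `(A ⊗ M_f) (Φ₁ ⊠ Φ₂) = (c_∞ c_f) • ((A₁ ⊗ M₁) Φ₁ ⊠ (A₂ ⊗ M₂) Φ₂)` for ALL `Φ_j ∈ 𝒮(𝔸_K^{ι_j})`
  (`adelicTensorEnd_tensorToSum_eq_smul`; bilinear-map form `compr₂_tensorToSum_adelicTensorEnd`; the
  `∃ c ≠ 0` packaging `exists_ne_zero_smul_tensorToSum`). The proof is two applications of the extensionality
  principle `linearMap_ext_tensor` (pure tensors `Φ^∞ ⊗ f` span `𝒮(𝔸_K^ι)`), one in each variable.

All operators in §2–§3 are ARBITRARY `ℂ`-linear maps (no continuity, no invertibility, no metaplectic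
hypothesis); the scalars `c_∞, c_f` are free (the identities need no `≠ 0`). The archimedean two-factor
Schur lemma producing `c_∞` and the finite one producing `c_f` live elsewhere
(`Analysis/SegalBargmann/SchwartzTensorSchurTransport`, resp. the finite Heisenberg Schur file); this leaf is
what lets the two halves meet without further glue.

## References

* [Weil1964] A. Weil, *Sur certains groupes d'opérateurs unitaires*, Acta Math. 111 (1964) 143–211, n° 29
  (standard functions on adelic vector spaces are finite sums of products of local ones), Chap. III n° 37–38
  p. 188–190 (`𝐫_A = ⊗_v 𝐫_v` over the places).
* [Tate1967] J. Tate, *Fourier analysis in number fields and Hecke's zeta-functions*, in Cassels–Fröhlich,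
  *Algebraic Number Theory* (1967), §3.2 (Schwartz–Bruhat functions on restricted products as tensor products).
-/

set_option autoImplicit false

noncomputable section

open NumberField NumberField.InfinitePlace NumberField.mixedEmbedding IsDedekindDomain

open scoped SchwartzMap TensorProduct Classical

namespace Literature.NumberTheory.Automorphic

variable {K : Type} [Field K] [NumberField K] {ι₁ ι₂ : Type} [Fintype ι₁] [Fintype ι₂]

/-! ## 1. `tensorToSum` on pure tensors -/

section Pure

/-- **`⊠` on pure tensors**: `(Φ₁^∞ ⊗ f₁) ⊠ (Φ₂^∞ ⊗ f₂) = (Φ₁^∞ ⊠_∞ Φ₂^∞) ⊗ (f₁ ⊠_f f₂)` in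
`𝒮(𝔸_K^{ι₁ ⊕ ι₂}) = 𝓢((K ⊗ ℝ)^{ι₁ ⊕ ι₂}) ⊗ 𝒮((𝔸_K^∞)^{ι₁ ⊕ ι₂})`, with `⊠_∞ = archBoxTensor` and
`f₁ ⊠_f f₂ = finSumEquiv (f₁ ⊗ f₂)`. (Weil 1964, n° 29; Tate 1967, §3.2.) [folklore] -/
theorem tensorToSum_tmul (Φ₁ : 𝓢((ι₁ → mixedSpace K), ℂ)) (f₁ : FinSB K ι₁)
    (Φ₂ : 𝓢((ι₂ → mixedSpace K), ℂ)) (f₂ : FinSB K ι₂) :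
    tensorToSum K ι₁ ι₂ (piSchwartzBruhatEquiv K ι₁ (Φ₁ ⊗ₜ f₁)) (piSchwartzBruhatEquiv K ι₂ (Φ₂ ⊗ₜ f₂)) =
      piSchwartzBruhatEquiv K (ι₁ ⊕ ι₂) (archBoxTensor Φ₁ Φ₂ ⊗ₜ finSumEquiv K ι₁ ι₂ (f₁ ⊗ₜ f₂)) := by
  apply Subtype.ext
  rw [coe_tensorToSum, coe_piSchwartzBruhatEquiv_tmul, coe_piSchwartzBruhatEquiv_tmul,
    coe_piSchwartzBruhatEquiv_tmul, coe_finSumEquiv_tmul]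
  funext v
  rw [boxTensor_apply, archBoxTensor_apply]
  exact mul_mul_mul_comm _ _ _ _

/-- The same in the triple-tensor model `𝓢((K ⊗ ℝ)^{ι₁ ⊕ ι₂}) ⊗ (FinSB K ι₁ ⊗ FinSB K ι₂)`:
`(Φ₁^∞ ⊗ f₁) ⊠ (Φ₂^∞ ⊗ f₂) = piSchwartzBruhatSumEquiv ((Φ₁^∞ ⊠_∞ Φ₂^∞) ⊗ (f₁ ⊗ f₂))`. [folklore] -/
theorem tensorToSum_tmul_eq_piSchwartzBruhatSumEquiv (Φ₁ : 𝓢((ι₁ → mixedSpace K), ℂ)) (f₁ : FinSB K ι₁)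
    (Φ₂ : 𝓢((ι₂ → mixedSpace K), ℂ)) (f₂ : FinSB K ι₂) :
    tensorToSum K ι₁ ι₂ (piSchwartzBruhatEquiv K ι₁ (Φ₁ ⊗ₜ f₁)) (piSchwartzBruhatEquiv K ι₂ (Φ₂ ⊗ₜ f₂)) =
      piSchwartzBruhatSumEquiv K ι₁ ι₂ (archBoxTensor Φ₁ Φ₂ ⊗ₜ (f₁ ⊗ₜ f₂)) := by
  rw [tensorToSum_tmul, piSchwartzBruhatSumEquiv_tmul]

/-- The pure-tensor product as a function on `𝔸_K^{ι₁ ⊕ ι₂}`: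
`((Φ₁^∞ ⊗ f₁) ⊠ (Φ₂^∞ ⊗ f₂))(v) = Φ₁^∞(v_∞|ι₁) Φ₂^∞(v_∞|ι₂) · f₁(v_f|ι₁) f₂(v_f|ι₂)`. [folklore] -/
theorem coe_tensorToSum_tmul (Φ₁ : 𝓢((ι₁ → mixedSpace K), ℂ)) (f₁ : FinSB K ι₁)
    (Φ₂ : 𝓢((ι₂ → mixedSpace K), ℂ)) (f₂ : FinSB K ι₂) :
    ((tensorToSum K ι₁ ι₂ (piSchwartzBruhatEquiv K ι₁ (Φ₁ ⊗ₜ f₁)) (piSchwartzBruhatEquiv K ι₂ (Φ₂ ⊗ₜ f₂)) :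
        ↥(piSchwartzBruhat K (ι₁ ⊕ ι₂))) : (ι₁ ⊕ ι₂ → AdeleRing (𝓞 K) K) → ℂ) =
      fun v => Φ₁ (resInl (piArch K (ι₁ ⊕ ι₂) v)) * Φ₂ (resInr (piArch K (ι₁ ⊕ ι₂) v)) *
        ((f₁ : (ι₁ → FiniteAdeleRing (𝓞 K) K) → ℂ) (resInl (piFinite K (ι₁ ⊕ ι₂) v)) *
          (f₂ : (ι₂ → FiniteAdeleRing (𝓞 K) K) → ℂ) (resInr (piFinite K (ι₁ ⊕ ι₂) v))) := by
  rw [tensorToSum_tmul, coe_piSchwartzBruhatEquiv_tmul, coe_finSumEquiv_tmul]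
  rfl

end Pure

/-! ## 2. Naturality of `⊠` under tensor-product operators, on pure tensors -/

section Naturality

/-- `(A ⊗ M_f) ((Φ₁^∞ ⊗ f₁) ⊠ (Φ₂^∞ ⊗ f₂)) = A (Φ₁^∞ ⊠_∞ Φ₂^∞) ⊗ M_f (f₁ ⊠_f f₂)` for arbitrary linear
`A` on `𝓢((K ⊗ ℝ)^{ι₁ ⊕ ι₂})` and `M_f` on `𝒮((𝔸_K^∞)^{ι₁ ⊕ ι₂})`. [folklore] -/
theorem adelicTensorEnd_tensorToSum_tmul
    (A : 𝓢((ι₁ ⊕ ι₂ → mixedSpace K), ℂ) →ₗ[ℂ] 𝓢((ι₁ ⊕ ι₂ → mixedSpace K), ℂ))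
    (Mf : FinSB K (ι₁ ⊕ ι₂) →ₗ[ℂ] FinSB K (ι₁ ⊕ ι₂))
    (Φ₁ : 𝓢((ι₁ → mixedSpace K), ℂ)) (f₁ : FinSB K ι₁)
    (Φ₂ : 𝓢((ι₂ → mixedSpace K), ℂ)) (f₂ : FinSB K ι₂) :
    adelicTensorEnd A Mf
        (tensorToSum K ι₁ ι₂ (piSchwartzBruhatEquiv K ι₁ (Φ₁ ⊗ₜ f₁)) (piSchwartzBruhatEquiv K ι₂ (Φ₂ ⊗ₜ f₂))) =
      piSchwartzBruhatEquiv K (ι₁ ⊕ ι₂) (A (archBoxTensor Φ₁ Φ₂) ⊗ₜ Mf (finSumEquiv K ι₁ ι₂ (f₁ ⊗ₜ f₂))) := by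
  rw [tensorToSum_tmul, adelicTensorEnd_apply_tmul]

/-- `((A₁ ⊗ M₁)(Φ₁^∞ ⊗ f₁)) ⊠ ((A₂ ⊗ M₂)(Φ₂^∞ ⊗ f₂)) = (A₁ Φ₁^∞ ⊠_∞ A₂ Φ₂^∞) ⊗ (M₁ f₁ ⊠_f M₂ f₂)` for
arbitrary linear `A_j` on `𝓢((K ⊗ ℝ)^{ι_j})` and `M_j` on `𝒮((𝔸_K^∞)^{ι_j})`. [folklore] -/
theorem tensorToSum_adelicTensorEnd_tmul
    (A₁ : 𝓢((ι₁ → mixedSpace K), ℂ) →ₗ[ℂ] 𝓢((ι₁ → mixedSpace K), ℂ)) (M₁ : FinSB K ι₁ →ₗ[ℂ] FinSB K ι₁)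
    (A₂ : 𝓢((ι₂ → mixedSpace K), ℂ) →ₗ[ℂ] 𝓢((ι₂ → mixedSpace K), ℂ)) (M₂ : FinSB K ι₂ →ₗ[ℂ] FinSB K ι₂)
    (Φ₁ : 𝓢((ι₁ → mixedSpace K), ℂ)) (f₁ : FinSB K ι₁)
    (Φ₂ : 𝓢((ι₂ → mixedSpace K), ℂ)) (f₂ : FinSB K ι₂) :
    tensorToSum K ι₁ ι₂ (adelicTensorEnd A₁ M₁ (piSchwartzBruhatEquiv K ι₁ (Φ₁ ⊗ₜ f₁)))
        (adelicTensorEnd A₂ M₂ (piSchwartzBruhatEquiv K ι₂ (Φ₂ ⊗ₜ f₂))) =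
      piSchwartzBruhatEquiv K (ι₁ ⊕ ι₂)
        (archBoxTensor (A₁ Φ₁) (A₂ Φ₂) ⊗ₜ finSumEquiv K ι₁ ι₂ (M₁ f₁ ⊗ₜ M₂ f₂)) := by
  rw [adelicTensorEnd_apply_tmul, adelicTensorEnd_apply_tmul, tensorToSum_tmul]

/-- The product operator `A ⊗ (M₁ ⊠ M₂)` is natural for `⊠` whenever `A` is natural for `⊠_∞` with scalar `c`:
`(A ⊗ finSumEnd M₁ M₂) ((Φ₁^∞ ⊗ f₁) ⊠ (Φ₂^∞ ⊗ f₂)) = c • (((A₁ ⊗ M₁)(Φ₁^∞ ⊗ f₁)) ⊠ ((A₂ ⊗ M₂)(Φ₂^∞ ⊗ f₂)))`.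
[folklore] -/
theorem adelicTensorEnd_finSumEnd_tensorToSum_tmul
    {A : 𝓢((ι₁ ⊕ ι₂ → mixedSpace K), ℂ) →ₗ[ℂ] 𝓢((ι₁ ⊕ ι₂ → mixedSpace K), ℂ)}
    {A₁ : 𝓢((ι₁ → mixedSpace K), ℂ) →ₗ[ℂ] 𝓢((ι₁ → mixedSpace K), ℂ)}
    {A₂ : 𝓢((ι₂ → mixedSpace K), ℂ) →ₗ[ℂ] 𝓢((ι₂ → mixedSpace K), ℂ)} {c : ℂ}
    (hA : ∀ (Φ₁ : 𝓢((ι₁ → mixedSpace K), ℂ)) (Φ₂ : 𝓢((ι₂ → mixedSpace K), ℂ)),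
      A (archBoxTensor Φ₁ Φ₂) = c • archBoxTensor (A₁ Φ₁) (A₂ Φ₂))
    (M₁ : FinSB K ι₁ →ₗ[ℂ] FinSB K ι₁) (M₂ : FinSB K ι₂ →ₗ[ℂ] FinSB K ι₂)
    (Φ₁ : 𝓢((ι₁ → mixedSpace K), ℂ)) (f₁ : FinSB K ι₁)
    (Φ₂ : 𝓢((ι₂ → mixedSpace K), ℂ)) (f₂ : FinSB K ι₂) :
    adelicTensorEnd A (finSumEnd M₁ M₂)
        (tensorToSum K ι₁ ι₂ (piSchwartzBruhatEquiv K ι₁ (Φ₁ ⊗ₜ f₁)) (piSchwartzBruhatEquiv K ι₂ (Φ₂ ⊗ₜ f₂))) =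
      c • tensorToSum K ι₁ ι₂ (adelicTensorEnd A₁ M₁ (piSchwartzBruhatEquiv K ι₁ (Φ₁ ⊗ₜ f₁)))
        (adelicTensorEnd A₂ M₂ (piSchwartzBruhatEquiv K ι₂ (Φ₂ ⊗ₜ f₂))) := by
  rw [adelicTensorEnd_tensorToSum_tmul, tensorToSum_adelicTensorEnd_tmul, hA, finSumEnd_apply_tmul,
    ← TensorProduct.smul_tmul', LinearEquiv.map_smul]

end Naturality

/-! ## 3. The two-scalar assembly lemma -/

section Assembly

variable {A : 𝓢((ι₁ ⊕ ι₂ → mixedSpace K), ℂ) →ₗ[ℂ] 𝓢((ι₁ ⊕ ι₂ → mixedSpace K), ℂ)}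
  {A₁ : 𝓢((ι₁ → mixedSpace K), ℂ) →ₗ[ℂ] 𝓢((ι₁ → mixedSpace K), ℂ)}
  {A₂ : 𝓢((ι₂ → mixedSpace K), ℂ) →ₗ[ℂ] 𝓢((ι₂ → mixedSpace K), ℂ)}
  {Mf : FinSB K (ι₁ ⊕ ι₂) →ₗ[ℂ] FinSB K (ι₁ ⊕ ι₂)}
  {M₁ : FinSB K ι₁ →ₗ[ℂ] FinSB K ι₁} {M₂ : FinSB K ι₂ →ₗ[ℂ] FinSB K ι₂} {cinf cfin : ℂ}

/-- **Two-scalar assembly on pure tensors.** If `A (Φ₁ ⊠_∞ Φ₂) = c_∞ • (A₁ Φ₁ ⊠_∞ A₂ Φ₂)` and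
`M_f (f₁ ⊠_f f₂) = c_f • (M₁ f₁ ⊠_f M₂ f₂)`, then
`(A ⊗ M_f) ((Φ₁^∞ ⊗ f₁) ⊠ (Φ₂^∞ ⊗ f₂)) = (c_∞ c_f) • (((A₁ ⊗ M₁)(Φ₁^∞ ⊗ f₁)) ⊠ ((A₂ ⊗ M₂)(Φ₂^∞ ⊗ f₂)))`.
[folklore] -/
theorem adelicTensorEnd_tensorToSum_tmul_eq_smul
    (hinf : ∀ (Φ₁ : 𝓢((ι₁ → mixedSpace K), ℂ)) (Φ₂ : 𝓢((ι₂ → mixedSpace K), ℂ)),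
      A (archBoxTensor Φ₁ Φ₂) = cinf • archBoxTensor (A₁ Φ₁) (A₂ Φ₂))
    (hfin : ∀ (f₁ : FinSB K ι₁) (f₂ : FinSB K ι₂),
      Mf (finSumEquiv K ι₁ ι₂ (f₁ ⊗ₜ f₂)) = cfin • finSumEquiv K ι₁ ι₂ (M₁ f₁ ⊗ₜ M₂ f₂))
    (Φ₁ : 𝓢((ι₁ → mixedSpace K), ℂ)) (f₁ : FinSB K ι₁)
    (Φ₂ : 𝓢((ι₂ → mixedSpace K), ℂ)) (f₂ : FinSB K ι₂) :
    adelicTensorEnd A Mf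
        (tensorToSum K ι₁ ι₂ (piSchwartzBruhatEquiv K ι₁ (Φ₁ ⊗ₜ f₁)) (piSchwartzBruhatEquiv K ι₂ (Φ₂ ⊗ₜ f₂))) =
      (cinf * cfin) • tensorToSum K ι₁ ι₂ (adelicTensorEnd A₁ M₁ (piSchwartzBruhatEquiv K ι₁ (Φ₁ ⊗ₜ f₁)))
        (adelicTensorEnd A₂ M₂ (piSchwartzBruhatEquiv K ι₂ (Φ₂ ⊗ₜ f₂))) := by
  rw [adelicTensorEnd_tensorToSum_tmul, tensorToSum_adelicTensorEnd_tmul, hinf, hfin,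
    TensorProduct.smul_tmul_smul, LinearEquiv.map_smul]

/-- **Two-scalar assembly, bilinear-map form**: under the hypotheses of
`adelicTensorEnd_tensorToSum_tmul_eq_smul`, `(A ⊗ M_f) ∘ ⊠ = (c_∞ c_f) • ⊠ ∘ ((A₁ ⊗ M₁) × (A₂ ⊗ M₂))` as bilinear
maps `𝒮(𝔸_K^{ι₁}) × 𝒮(𝔸_K^{ι₂}) → 𝒮(𝔸_K^{ι₁ ⊕ ι₂})` — two applications of `linearMap_ext_tensor` (pure tensors
span), one in each variable. [folklore] -/
theorem compr₂_tensorToSum_adelicTensorEnd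
    (hinf : ∀ (Φ₁ : 𝓢((ι₁ → mixedSpace K), ℂ)) (Φ₂ : 𝓢((ι₂ → mixedSpace K), ℂ)),
      A (archBoxTensor Φ₁ Φ₂) = cinf • archBoxTensor (A₁ Φ₁) (A₂ Φ₂))
    (hfin : ∀ (f₁ : FinSB K ι₁) (f₂ : FinSB K ι₂),
      Mf (finSumEquiv K ι₁ ι₂ (f₁ ⊗ₜ f₂)) = cfin • finSumEquiv K ι₁ ι₂ (M₁ f₁ ⊗ₜ M₂ f₂)) :
    (tensorToSum K ι₁ ι₂).compr₂ (adelicTensorEnd A Mf) =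
      (cinf * cfin) • (tensorToSum K ι₁ ι₂).compl₁₂ (adelicTensorEnd A₁ M₁) (adelicTensorEnd A₂ M₂) := by
  refine linearMap_ext_tensor fun Φ₁ f₁ => ?_
  refine linearMap_ext_tensor fun Φ₂ f₂ => ?_
  simp only [LinearMap.compr₂_apply, LinearMap.smul_apply, LinearMap.compl₁₂_apply]
  exact adelicTensorEnd_tensorToSum_tmul_eq_smul hinf hfin Φ₁ f₁ Φ₂ f₂

/-- **THE TWO-SCALAR ASSEMBLY LEMMA.** Let `A, A₁, A₂` be linear operators on `𝓢((K ⊗ ℝ)^{ι₁ ⊕ ι₂})`,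
`𝓢((K ⊗ ℝ)^{ι₁})`, `𝓢((K ⊗ ℝ)^{ι₂})` with `A (Φ₁ ⊠_∞ Φ₂) = c_∞ • (A₁ Φ₁ ⊠_∞ A₂ Φ₂)` for all `Φ₁, Φ₂`, and
`M_f, M₁, M₂` linear operators on `𝒮((𝔸_K^∞)^{ι₁ ⊕ ι₂})`, `𝒮((𝔸_K^∞)^{ι₁})`, `𝒮((𝔸_K^∞)^{ι₂})` with
`M_f (f₁ ⊠_f f₂) = c_f • (M₁ f₁ ⊠_f M₂ f₂)` for all `f₁, f₂`. Then for ALL `Φ₁ ∈ 𝒮(𝔸_K^{ι₁})`, `Φ₂ ∈ 𝒮(𝔸_K^{ι₂})`: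
`(A ⊗ M_f) (Φ₁ ⊠ Φ₂) = (c_∞ c_f) • ((A₁ ⊗ M₁) Φ₁ ⊠ (A₂ ⊗ M₂) Φ₂)`. (The operator-level form of Weil's
`𝐫_A(s) = ⊗_v 𝐫_v(s_v)` across a direct sum, Weil 1964 n° 37–38, once the local scalars are known.) [folklore] -/
theorem adelicTensorEnd_tensorToSum_eq_smul
    (hinf : ∀ (Φ₁ : 𝓢((ι₁ → mixedSpace K), ℂ)) (Φ₂ : 𝓢((ι₂ → mixedSpace K), ℂ)),
      A (archBoxTensor Φ₁ Φ₂) = cinf • archBoxTensor (A₁ Φ₁) (A₂ Φ₂))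
    (hfin : ∀ (f₁ : FinSB K ι₁) (f₂ : FinSB K ι₂),
      Mf (finSumEquiv K ι₁ ι₂ (f₁ ⊗ₜ f₂)) = cfin • finSumEquiv K ι₁ ι₂ (M₁ f₁ ⊗ₜ M₂ f₂))
    (Φ₁ : piSchwartzBruhat K ι₁) (Φ₂ : piSchwartzBruhat K ι₂) :
    adelicTensorEnd A Mf (tensorToSum K ι₁ ι₂ Φ₁ Φ₂) =
      (cinf * cfin) • tensorToSum K ι₁ ι₂ (adelicTensorEnd A₁ M₁ Φ₁) (adelicTensorEnd A₂ M₂ Φ₂) := by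
  have h := LinearMap.congr_fun (LinearMap.congr_fun (compr₂_tensorToSum_adelicTensorEnd hinf hfin) Φ₁) Φ₂
  simpa only [LinearMap.compr₂_apply, LinearMap.smul_apply, LinearMap.compl₁₂_apply] using h

/-- Operator form in the second variable: for fixed `Φ₁`,
`(A ⊗ M_f) ∘ (Φ₁ ⊠ ·) = (c_∞ c_f) • ((A₁ ⊗ M₁) Φ₁ ⊠ ·) ∘ (A₂ ⊗ M₂)`. [folklore] -/
theorem adelicTensorEnd_comp_tensorToSum_eq_smul
    (hinf : ∀ (Φ₁ : 𝓢((ι₁ → mixedSpace K), ℂ)) (Φ₂ : 𝓢((ι₂ → mixedSpace K), ℂ)),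
      A (archBoxTensor Φ₁ Φ₂) = cinf • archBoxTensor (A₁ Φ₁) (A₂ Φ₂))
    (hfin : ∀ (f₁ : FinSB K ι₁) (f₂ : FinSB K ι₂),
      Mf (finSumEquiv K ι₁ ι₂ (f₁ ⊗ₜ f₂)) = cfin • finSumEquiv K ι₁ ι₂ (M₁ f₁ ⊗ₜ M₂ f₂))
    (Φ₁ : piSchwartzBruhat K ι₁) :
    adelicTensorEnd A Mf ∘ₗ tensorToSum K ι₁ ι₂ Φ₁ =
      (cinf * cfin) • (tensorToSum K ι₁ ι₂ (adelicTensorEnd A₁ M₁ Φ₁) ∘ₗ adelicTensorEnd A₂ M₂) := by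
  refine LinearMap.ext fun Φ₂ => ?_
  simp only [LinearMap.comp_apply, LinearMap.smul_apply]
  exact adelicTensorEnd_tensorToSum_eq_smul hinf hfin Φ₁ Φ₂

/-- **Packaging for the two-factor Schur lemma.** If the adelic operators `M, T₁, T₂` ARE tensor-product
operators `M = A ⊗ M_f`, `T_j = A_j ⊗ M_j` (e.g. by tensor stripping), the archimedean parts act on
separate-variable products by a scalar `c_∞ ≠ 0` and the finite parts by a scalar `c_f ≠ 0`, then
`M (Φ₁ ⊠ Φ₂) = c • (T₁ Φ₁ ⊠ T₂ Φ₂)` for ONE scalar `c ≠ 0` (namely `c = c_∞ c_f`) and all `Φ₁, Φ₂`. [folklore] -/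
theorem exists_ne_zero_smul_tensorToSum
    {M : ↥(piSchwartzBruhat K (ι₁ ⊕ ι₂)) →ₗ[ℂ] ↥(piSchwartzBruhat K (ι₁ ⊕ ι₂))}
    {T₁ : ↥(piSchwartzBruhat K ι₁) →ₗ[ℂ] ↥(piSchwartzBruhat K ι₁)}
    {T₂ : ↥(piSchwartzBruhat K ι₂) →ₗ[ℂ] ↥(piSchwartzBruhat K ι₂)}
    (hM : M = adelicTensorEnd A Mf) (hT₁ : T₁ = adelicTensorEnd A₁ M₁) (hT₂ : T₂ = adelicTensorEnd A₂ M₂)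
    (hinf : ∃ cinf : ℂ, cinf ≠ 0 ∧ ∀ (Φ₁ : 𝓢((ι₁ → mixedSpace K), ℂ)) (Φ₂ : 𝓢((ι₂ → mixedSpace K), ℂ)),
      A (archBoxTensor Φ₁ Φ₂) = cinf • archBoxTensor (A₁ Φ₁) (A₂ Φ₂))
    (hfin : ∃ cfin : ℂ, cfin ≠ 0 ∧ ∀ (f₁ : FinSB K ι₁) (f₂ : FinSB K ι₂),
      Mf (finSumEquiv K ι₁ ι₂ (f₁ ⊗ₜ f₂)) = cfin • finSumEquiv K ι₁ ι₂ (M₁ f₁ ⊗ₜ M₂ f₂)) :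
    ∃ c : ℂ, c ≠ 0 ∧ ∀ (Φ₁ : piSchwartzBruhat K ι₁) (Φ₂ : piSchwartzBruhat K ι₂),
      M (tensorToSum K ι₁ ι₂ Φ₁ Φ₂) = c • tensorToSum K ι₁ ι₂ (T₁ Φ₁) (T₂ Φ₂) := by
  obtain ⟨cinf, hcinf, hinf⟩ := hinf
  obtain ⟨cfin, hcfin, hfin⟩ := hfin
  subst hM hT₁ hT₂
  exact ⟨cinf * cfin, mul_ne_zero hcinf hcfin, adelicTensorEnd_tensorToSum_eq_smul hinf hfin⟩

end Assembly

end Literature.NumberTheory.Automorphic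

end
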